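import Summits.CriticalPhenomena.PercolationContinuityZ3.Theorems.PercNearOneGluingNoHeavyQuantFarTwoHubReach
import Summits.CriticalPhenomena.PercolationContinuityZ3.Theorems.PercNearOneGluingNoHeavyQuantFarTwoAnchorLaw
import HarnessLib

/-!
# QUANT lane R8, front "FAR beyond trees", layer one — TWO-HUB BLOCKS II: the internal law (independence of core and hubs; `P(X ≥ 1)`, `P(X ≥ 2)`)

builds on p205010 (kernel theorem, internal audit signed; external expert review pending)

Support file (`--supports stmt-CriticalPhenomena-4575`), seat `prim-quant-p1` (gen 19); memo
`run/shared/lean/prim/quant/prim-quant-p1-g19/FOR-LEAD-CACTI.md` §5.  Standard axioms; no sorries.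

Setting of `…QuantFarTwoHubReach` (`Block.IsTwoHub c v₁ v₂ Z S₁ S₂`): the anchors carry arbitrary hubs `S₁, S₂`; block relays
`A ∩ Z ⊆ S₁ ∪ S₂ ∪ {v₁, v₂}`; loaded counts `Yᵢ + bᵢ`, `Yᵢ = #{a ∈ A ∩ Sᵢ : vᵢ ↔ a inside}`, `bᵢ = 𝟙[vᵢ ∈ A]`.  The core pattern is determined by
`corePairs Z (S₁ ∪ S₂)`, `Yᵢ` by the hub pairs `Block.hubPairs Sᵢ vᵢ` (pairs inside `Sᵢ ∪ {vᵢ}` meeting `Sᵢ`); the three pair sets are pairwise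
disjoint, hence independent under `prodBernoulli v` (`Block.real_core_hub_hub`).  For `v` hanging `Sᵢ` at `vᵢ` (a.s. good, `Block.real_congr_of_good₂`):
* `Block.real_one_le_X_eq_hub`, `Block.real_two_le_X_eq_hub` — the product formulas of `…TwoAnchorLaw` with the hub counts.
[cite: Grimmett1999, §1.3 p. 10; §2.2]; bookkeeping [this work].
-/

noncomputable section

namespace Summit.CriticalPhenomena.PercolationContinuityZ3.Theorems

namespace Quant

namespace Block

open Finset MeasureTheory Set
open Literature.Probability.LatticeModels
open Literature.Probability.Percolation
open scoped Classical

variable {n : ℕ}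

/-- The hub pairs: pairs inside `S ∪ {v}` meeting `S`. [this work] -/
def hubPairs (S : Finset (Fin n)) (v : Fin n) : Finset (Sym2 (Fin n)) :=
  Finset.univ.filter fun e => (∃ z ∈ S, z ∈ e) ∧ ∀ z, z ∈ e → z ∈ S ∨ z = v

/-- `inS S v ω` is `ω` restricted to the hub pairs. [this work] -/
theorem inS_eq_inter (S : Finset (Fin n)) (v : Fin n) (ω : BondConfig (Fin n)) : inS S v ω = ω ∩ ↑(hubPairs S v) := by
  ext e
  simp only [inS, hubPairs, Set.mem_setOf_eq, Set.mem_inter_iff, Finset.coe_filter, Finset.mem_univ, true_and]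

/-- Any event read off the inner pairs of a hub is determined by the hub pairs. [this work] -/
theorem determinedBy_inS (S : Finset (Fin n)) (v : Fin n) (P : BondConfig (Fin n) → Prop) :
    DeterminedBy {ω : BondConfig (Fin n) | P (inS S v ω)} (↑(hubPairs S v) : Set (Sym2 (Fin n))) := by
  rw [determinedBy_iff]
  intro ω ω' h
  simp only [mem_setOf_eq, inS_eq_inter, h]

/-- Any event read off the inner count of a hub is determined by the hub pairs. [this work] -/
theorem determinedBy_hub (S : Finset (Fin n)) (v : Fin n) (B : Finset (Fin n)) (P : ℕ → Prop) :
    DeterminedBy {ω : BondConfig (Fin n) | P ((B.filter fun a => inS S v ω ∈ openConn v a).card)} (↑(hubPairs S v) : Set (Sym2 (Fin n))) := by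
  rw [determinedBy_iff]
  intro ω ω' h
  simp only [mem_setOf_eq, inS_eq_inter, h]

/-- Hub pairs avoid the core pairs. [this work] -/
theorem disjoint_core_hub {Z S₁ S₂ S : Finset (Fin n)} (v : Fin n) (hS : S ⊆ S₁ ∪ S₂) : Disjoint (corePairs Z (S₁ ∪ S₂)) (hubPairs S v) := by
  rw [Finset.disjoint_left]
  intro e he he'
  obtain ⟨⟨z, hz, hze⟩, -⟩ := (Finset.mem_filter.1 he').2
  exact (Finset.mem_filter.1 he).2.2 z (hS hz) hze

section TwoHub

variable {c v₁ v₂ : Fin n} {Z S₁ S₂ : Finset (Fin n)} (H : IsTwoHub c v₁ v₂ Z S₁ S₂)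
include H

/-- The two hubs' pair sets are disjoint. [this work] -/
theorem disjoint_hub_hub : Disjoint (hubPairs S₁ v₁) (hubPairs S₂ v₂) := by
  rw [Finset.disjoint_left]
  intro e h1 h2
  obtain ⟨-, hin⟩ := (Finset.mem_filter.1 h1).2
  obtain ⟨⟨z, hz, hze⟩, -⟩ := (Finset.mem_filter.1 h2).2
  rcases hin z hze with h | h
  · exact Finset.disjoint_left.1 H.disj h hz
  · exact H.v₁S₂ (h ▸ hz)

/-- **Independence of core pattern and the two hubs**: `P(E ∩ F₁ ∩ F₂) = P(E)·P(F₁)·P(F₂)` for `E` determined by the core pairs and `Fᵢ` by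
the hub pairs of `Sᵢ`. [this work] -/
theorem real_core_hub_hub (v : Sym2 (Fin n) → unitInterval) {E F₁ F₂ : Set (BondConfig (Fin n))}
    (hE : DeterminedBy E (↑(corePairs Z (S₁ ∪ S₂)) : Set (Sym2 (Fin n))))
    (hF₁ : DeterminedBy F₁ (↑(hubPairs S₁ v₁) : Set (Sym2 (Fin n)))) (hF₂ : DeterminedBy F₂ (↑(hubPairs S₂ v₂) : Set (Sym2 (Fin n)))) :
    (prodBernoulli v).real (E ∩ F₁ ∩ F₂) = (prodBernoulli v).real E * (prodBernoulli v).real F₁ * (prodBernoulli v).real F₂ := by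
  have hmeas : ∀ U : Set (BondConfig (Fin n)), MeasurableSet U := fun U => (Set.toFinite U).measurableSet
  have hsub₁ : (↑(hubPairs S₁ v₁) : Set (Sym2 (Fin n))) ⊆ (↑(corePairs Z (S₁ ∪ S₂)) : Set (Sym2 (Fin n)))ᶜ := by
    intro e he hc
    exact Finset.disjoint_left.1 (disjoint_core_hub (Z := Z) v₁ Finset.subset_union_left) (Finset.mem_coe.1 hc) (Finset.mem_coe.1 he)
  have hsub₂ : (↑(hubPairs S₂ v₂) : Set (Sym2 (Fin n))) ⊆ (↑(corePairs Z (S₁ ∪ S₂)) : Set (Sym2 (Fin n)))ᶜ := by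
    intro e he hc
    exact Finset.disjoint_left.1 (disjoint_core_hub (Z := Z) v₂ Finset.subset_union_right) (Finset.mem_coe.1 hc) (Finset.mem_coe.1 he)
  have hF : DeterminedBy (F₁ ∩ F₂) (↑(corePairs Z (S₁ ∪ S₂)) : Set (Sym2 (Fin n)))ᶜ := (hF₁.mono hsub₁).inter (hF₂.mono hsub₂)
  rw [Set.inter_assoc, prodBernoulli_real_inter_of_determinedBy v (corePairs Z (S₁ ∪ S₂)) hE hF (hmeas _) (hmeas _),
    prodBernoulli_real_inter_of_determinedBy_disjoint v (disjoint_hub_hub H) hF₁ hF₂ (hmeas _) (hmeas _), mul_assoc]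

/-- Two-factor form, hub 1. [this work] -/
theorem real_core_hub₁ (v : Sym2 (Fin n) → unitInterval) {E F₁ : Set (BondConfig (Fin n))}
    (hE : DeterminedBy E (↑(corePairs Z (S₁ ∪ S₂)) : Set (Sym2 (Fin n)))) (hF₁ : DeterminedBy F₁ (↑(hubPairs S₁ v₁) : Set (Sym2 (Fin n)))) :
    (prodBernoulli v).real (E ∩ F₁) = (prodBernoulli v).real E * (prodBernoulli v).real F₁ := by
  have h := real_core_hub_hub H v hE hF₁ (determinedBy_univ _)
  rw [Set.inter_univ] at h
  rw [h, probReal_univ, mul_one]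

/-- Two-factor form, hub 2. [this work] -/
theorem real_core_hub₂ (v : Sym2 (Fin n) → unitInterval) {E F₂ : Set (BondConfig (Fin n))}
    (hE : DeterminedBy E (↑(corePairs Z (S₁ ∪ S₂)) : Set (Sym2 (Fin n)))) (hF₂ : DeterminedBy F₂ (↑(hubPairs S₂ v₂) : Set (Sym2 (Fin n)))) :
    (prodBernoulli v).real (E ∩ F₂) = (prodBernoulli v).real E * (prodBernoulli v).real F₂ := by
  have h := real_core_hub_hub H v hE (determinedBy_univ _) hF₂
  rw [Set.inter_univ] at h
  rw [h, probReal_univ, mul_one]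

/-! ## Almost-sure goodness of both hubs -/

omit H in
/-- If `v` hangs `S₁` at `v₁` and `S₂` at `v₂`, the configuration is almost surely good for both hubs. [this work] -/
theorem real_congr_of_good₂ (v : Sym2 (Fin n) → unitInterval)
    (hv₁ : ∀ x y : Fin n, x ≠ y → x ∈ S₁ → y ∉ S₁ → y ≠ v₁ → (v s(x, y) : ℝ) = 0)
    (hv₂ : ∀ x y : Fin n, x ≠ y → x ∈ S₂ → y ∉ S₂ → y ≠ v₂ → (v s(x, y) : ℝ) = 0)
    (S T : Set (BondConfig (Fin n))) (hST : ∀ ω, Good v₁ S₁ ω ∧ Good v₂ S₂ ω → (ω ∈ S ↔ ω ∈ T)) :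
    (prodBernoulli v).real S = (prodBernoulli v).real T := by
  -- first pass to the configurations good for `S₁`, then for `S₂`
  have h1 : (prodBernoulli v).real S = (prodBernoulli v).real {ω | (Good v₂ S₂ ω → ω ∈ T) ∧ (¬ Good v₂ S₂ ω → ω ∈ S)} :=
    real_congr_of_good (c := v₁) (Z := S₁) v hv₁ _ _ fun ω hω => by
      simp only [mem_setOf_eq]
      by_cases h2 : Good v₂ S₂ ω
      · simp only [h2, forall_true_left, not_true_eq_false, IsEmpty.forall_iff, and_true]; exact hST ω ⟨hω, h2⟩
      · simp only [h2, IsEmpty.forall_iff, not_false_eq_true, forall_true_left, true_and]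
  rw [h1]
  exact real_congr_of_good (c := v₂) (Z := S₂) v hv₂ _ _ fun ω hω => by
    simp only [mem_setOf_eq, hω, forall_true_left, not_true_eq_false, IsEmpty.forall_iff, and_true]

/-! ## The internal law -/

/-- **`P(X ≥ 1)` of a two-anchor block** (block relays are leaves, a.s. leaf-good weights): with `Eᵢ = {c ↔ vᵢ in core}`,
`Aᵢ = {a ∈ A ∩ Z : par a = vᵢ}`, `Yᵢ = #{ℓ ∈ Aᵢ : s(vᵢ,ℓ) open}`:
`P(X ≥ 1) = P(E₁∖E₂)P(Y₁≥1) + P(E₂∖E₁)P(Y₂≥1) + P(E₁∩E₂)P(Y₁≥1) + P(E₁∩E₂)P(Y₁=0)P(Y₂≥1)`. [this work] -/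
theorem real_one_le_X_eq_hub (v : Sym2 (Fin n) → unitInterval)
    (hv₁ : ∀ x y : Fin n, x ≠ y → x ∈ S₁ → y ∉ S₁ → y ≠ v₁ → (v s(x, y) : ℝ) = 0)
    (hv₂ : ∀ x y : Fin n, x ≠ y → x ∈ S₂ → y ∉ S₂ → y ≠ v₂ → (v s(x, y) : ℝ) = 0) {A : Finset (Fin n)} (hA : A ∩ Z ⊆ S₁ ∪ S₂ ∪ {v₁, v₂}) :
    (prodBernoulli v).real {ω | 1 ≤ ((A ∩ Z).filter fun a => onZ Z ω ∈ openConn c a).card} =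
      (prodBernoulli v).real ({ω | core Z (S₁ ∪ S₂) ω ∈ openConn c v₁} \ {ω | core Z (S₁ ∪ S₂) ω ∈ openConn c v₂}) *
        (prodBernoulli v).real {ω | 1 ≤ (((A ∩ S₁).filter fun a => inS S₁ v₁ ω ∈ openConn v₁ a).card + (if v₁ ∈ A then 1 else 0))} +
      (prodBernoulli v).real ({ω | core Z (S₁ ∪ S₂) ω ∈ openConn c v₂} \ {ω | core Z (S₁ ∪ S₂) ω ∈ openConn c v₁}) *
        (prodBernoulli v).real {ω | 1 ≤ (((A ∩ S₂).filter fun a => inS S₂ v₂ ω ∈ openConn v₂ a).card + (if v₂ ∈ A then 1 else 0))} +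
      (prodBernoulli v).real ({ω | core Z (S₁ ∪ S₂) ω ∈ openConn c v₁} ∩ {ω | core Z (S₁ ∪ S₂) ω ∈ openConn c v₂}) *
        (prodBernoulli v).real {ω | 1 ≤ (((A ∩ S₁).filter fun a => inS S₁ v₁ ω ∈ openConn v₁ a).card + (if v₁ ∈ A then 1 else 0))} +
      (prodBernoulli v).real ({ω | core Z (S₁ ∪ S₂) ω ∈ openConn c v₁} ∩ {ω | core Z (S₁ ∪ S₂) ω ∈ openConn c v₂}) *
        (prodBernoulli v).real {ω | (((A ∩ S₁).filter fun a => inS S₁ v₁ ω ∈ openConn v₁ a).card + (if v₁ ∈ A then 1 else 0)) = 0} *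
        (prodBernoulli v).real {ω | 1 ≤ (((A ∩ S₂).filter fun a => inS S₂ v₂ ω ∈ openConn v₂ a).card + (if v₂ ∈ A then 1 else 0))} := by
  set μ := prodBernoulli v with hμ
  have hmeas : ∀ U : Set (BondConfig (Fin n)), MeasurableSet U := fun U => (Set.toFinite U).measurableSet
  set A₁ := A ∩ S₁ with hA₁
  set A₂ := A ∩ S₂ with hA₂
  have hA₁L : A₁ ⊆ S₁ := fun a ha => (mem_inter.1 ha).2
  have hA₂L : A₂ ⊆ S₂ := fun a ha => (mem_inter.1 ha).2
  set b₁ : ℕ := (if v₁ ∈ A then 1 else 0) with hb₁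
  set b₂ : ℕ := (if v₂ ∈ A then 1 else 0) with hb₂
  set E₁ := {ω : BondConfig (Fin n) | core Z (S₁ ∪ S₂) ω ∈ openConn c v₁} with hE₁
  set E₂ := {ω : BondConfig (Fin n) | core Z (S₁ ∪ S₂) ω ∈ openConn c v₂} with hE₂
  set S := {ω : BondConfig (Fin n) | 1 ≤ ((A ∩ Z).filter fun a => onZ Z ω ∈ openConn c a).card} with hS
  set G₁ := {ω : BondConfig (Fin n) | 1 ≤ ((A₁.filter fun a => inS S₁ v₁ ω ∈ openConn v₁ a).card + b₁)} with hG₁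
  set G₂ := {ω : BondConfig (Fin n) | 1 ≤ ((A₂.filter fun a => inS S₂ v₂ ω ∈ openConn v₂ a).card + b₂)} with hG₂
  set Z₁ := {ω : BondConfig (Fin n) | ((A₁.filter fun a => inS S₁ v₁ ω ∈ openConn v₁ a).card + b₁) = 0} with hZ₁
  -- the count on leaf-good configurations
  have hX : ∀ ω, Good v₁ S₁ ω ∧ Good v₂ S₂ ω → ((A ∩ Z).filter fun a => onZ Z ω ∈ openConn c a).card =
      (if ω ∈ E₁ then ((A₁.filter fun a => inS S₁ v₁ ω ∈ openConn v₁ a).card + b₁) else 0) +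
      (if ω ∈ E₂ then ((A₂.filter fun a => inS S₂ v₂ ω ∈ openConn v₂ a).card + b₂) else 0) := fun ω hω => card_on_eq_twoHub H hω.1 hω.2 hA
  -- determinacy
  have hdE : ∀ (P : Prop → Prop → Prop), DeterminedBy {ω | P (ω ∈ E₁) (ω ∈ E₂)} (↑(corePairs Z (S₁ ∪ S₂)) : Set (Sym2 (Fin n))) :=
    fun P => determinedBy_core Z (S₁ ∪ S₂) fun η => P (η ∈ openConn c v₁) (η ∈ openConn c v₂)
  have hdG₁ : DeterminedBy G₁ (↑(hubPairs S₁ v₁) : Set (Sym2 (Fin n))) := determinedBy_hub S₁ v₁ A₁ fun k => 1 ≤ k + b₁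
  have hdG₂ : DeterminedBy G₂ (↑(hubPairs S₂ v₂) : Set (Sym2 (Fin n))) := determinedBy_hub S₂ v₂ A₂ fun k => 1 ≤ k + b₂
  have hdZ₁ : DeterminedBy Z₁ (↑(hubPairs S₁ v₁) : Set (Sym2 (Fin n))) := determinedBy_hub S₁ v₁ A₁ fun k => k + b₁ = 0
  -- splits
  have s1 := measureReal_inter_add_sdiff (μ := μ) (s := S) (hmeas E₁)
  have s2 := measureReal_inter_add_sdiff (μ := μ) (s := S ∩ E₁) (hmeas E₂)
  have s3 := measureReal_inter_add_sdiff (μ := μ) (s := S \ E₁) (hmeas E₂)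
  have s4 := measureReal_inter_add_sdiff (μ := μ) (s := S ∩ E₁ ∩ E₂) (hmeas G₁)
  -- identification of the pieces on leaf-good configurations
  have p1 : μ.real ((S ∩ E₁) \ E₂) = μ.real ({ω | ω ∈ E₁ ∧ ¬ ω ∈ E₂} ∩ G₁) := by
    refine real_congr_of_good₂ v hv₁ hv₂ _ _ fun ω hω => ?_
    simp only [Set.mem_sdiff, Set.mem_inter_iff, mem_setOf_eq, hS, hG₁]
    rw [hX ω hω]
    by_cases h1 : ω ∈ E₁ <;> by_cases h2 : ω ∈ E₂ <;>
      simp only [h1, h2, if_true, if_false, true_and, and_true, false_and, and_false, not_true_eq_false, not_false_eq_true, add_zero, zero_add]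
  have p2 : μ.real ((S \ E₁) ∩ E₂) = μ.real ({ω | ω ∈ E₂ ∧ ¬ ω ∈ E₁} ∩ G₂) := by
    refine real_congr_of_good₂ v hv₁ hv₂ _ _ fun ω hω => ?_
    simp only [Set.mem_sdiff, Set.mem_inter_iff, mem_setOf_eq, hS, hG₂]
    rw [hX ω hω]
    by_cases h1 : ω ∈ E₁ <;> by_cases h2 : ω ∈ E₂ <;>
      simp only [h1, h2, if_true, if_false, true_and, and_true, false_and, and_false, not_true_eq_false, not_false_eq_true, add_zero, zero_add]
  have p3 : μ.real ((S \ E₁) \ E₂) = 0 := by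
    have : μ.real ((S \ E₁) \ E₂) = μ.real (∅ : Set (BondConfig (Fin n))) := by
      refine real_congr_of_good₂ v hv₁ hv₂ _ _ fun ω hω => ?_
      simp only [Set.mem_sdiff, mem_setOf_eq, hS, Set.mem_empty_iff_false, iff_false]
      rw [hX ω hω]
      by_cases h1 : ω ∈ E₁ <;> by_cases h2 : ω ∈ E₂ <;>
        simp only [h1, h2, if_true, if_false, and_true, and_false, not_true_eq_false, not_false_eq_true, add_zero, zero_add, not_le]
      omega
    rw [this, measureReal_empty]
  have p4 : μ.real (S ∩ E₁ ∩ E₂ ∩ G₁) = μ.real ({ω | ω ∈ E₁ ∧ ω ∈ E₂} ∩ G₁) := by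
    refine real_congr_of_good₂ v hv₁ hv₂ _ _ fun ω hω => ?_
    simp only [Set.mem_inter_iff, mem_setOf_eq, hS, hG₁]
    rw [hX ω hω]
    by_cases h1 : ω ∈ E₁ <;> by_cases h2 : ω ∈ E₂ <;>
      simp only [h1, h2, if_true, if_false, true_and, and_true, false_and, and_false, add_zero, zero_add]
    omega
  have p5 : μ.real ((S ∩ E₁ ∩ E₂) \ G₁) = μ.real ({ω | ω ∈ E₁ ∧ ω ∈ E₂} ∩ Z₁ ∩ G₂) := by
    refine real_congr_of_good₂ v hv₁ hv₂ _ _ fun ω hω => ?_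
    simp only [Set.mem_sdiff, Set.mem_inter_iff, mem_setOf_eq, hS, hG₁, hZ₁, hG₂]
    rw [hX ω hω]
    by_cases h1 : ω ∈ E₁ <;> by_cases h2 : ω ∈ E₂ <;>
      simp only [h1, h2, if_true, if_false, true_and, and_true, false_and, and_false, add_zero, zero_add, not_le]
    omega
  -- independence
  rw [real_core_hub₁ H v (hdE fun a b => a ∧ ¬ b) hdG₁] at p1
  rw [real_core_hub₂ H v (hdE fun a b => b ∧ ¬ a) hdG₂] at p2
  rw [real_core_hub₁ H v (hdE fun a b => a ∧ b) hdG₁] at p4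
  rw [real_core_hub_hub H v (hdE fun a b => a ∧ b) hdZ₁ hdG₂] at p5
  -- the pattern events as differences / intersections
  have e10 : {ω : BondConfig (Fin n) | ω ∈ E₁ ∧ ¬ ω ∈ E₂} = E₁ \ E₂ := rfl
  have e01 : {ω : BondConfig (Fin n) | ω ∈ E₂ ∧ ¬ ω ∈ E₁} = E₂ \ E₁ := rfl
  have e11 : {ω : BondConfig (Fin n) | ω ∈ E₁ ∧ ω ∈ E₂} = E₁ ∩ E₂ := rfl
  rw [e10] at p1; rw [e01] at p2; rw [e11] at p4 p5
  linarith [s1, s2, s3, s4, p1, p2, p3, p4, p5]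

/-- **`P(X ≥ 2)` of a two-anchor block**:
`P(X ≥ 2) = P(E₁∖E₂)P(Y₁≥2) + P(E₂∖E₁)P(Y₂≥2) + P(E₁∩E₂)P(Y₁≥2) + P(E₁∩E₂)P(Y₁=1)P(Y₂≥1) + P(E₁∩E₂)P(Y₁=0)P(Y₂≥2)`. [this work] -/
theorem real_two_le_X_eq_hub (v : Sym2 (Fin n) → unitInterval)
    (hv₁ : ∀ x y : Fin n, x ≠ y → x ∈ S₁ → y ∉ S₁ → y ≠ v₁ → (v s(x, y) : ℝ) = 0)
    (hv₂ : ∀ x y : Fin n, x ≠ y → x ∈ S₂ → y ∉ S₂ → y ≠ v₂ → (v s(x, y) : ℝ) = 0) {A : Finset (Fin n)} (hA : A ∩ Z ⊆ S₁ ∪ S₂ ∪ {v₁, v₂}) :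
    (prodBernoulli v).real {ω | 2 ≤ ((A ∩ Z).filter fun a => onZ Z ω ∈ openConn c a).card} =
      (prodBernoulli v).real ({ω | core Z (S₁ ∪ S₂) ω ∈ openConn c v₁} \ {ω | core Z (S₁ ∪ S₂) ω ∈ openConn c v₂}) *
        (prodBernoulli v).real {ω | 2 ≤ (((A ∩ S₁).filter fun a => inS S₁ v₁ ω ∈ openConn v₁ a).card + (if v₁ ∈ A then 1 else 0))} +
      (prodBernoulli v).real ({ω | core Z (S₁ ∪ S₂) ω ∈ openConn c v₂} \ {ω | core Z (S₁ ∪ S₂) ω ∈ openConn c v₁}) *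
        (prodBernoulli v).real {ω | 2 ≤ (((A ∩ S₂).filter fun a => inS S₂ v₂ ω ∈ openConn v₂ a).card + (if v₂ ∈ A then 1 else 0))} +
      (prodBernoulli v).real ({ω | core Z (S₁ ∪ S₂) ω ∈ openConn c v₁} ∩ {ω | core Z (S₁ ∪ S₂) ω ∈ openConn c v₂}) *
        (prodBernoulli v).real {ω | 2 ≤ (((A ∩ S₁).filter fun a => inS S₁ v₁ ω ∈ openConn v₁ a).card + (if v₁ ∈ A then 1 else 0))} +
      (prodBernoulli v).real ({ω | core Z (S₁ ∪ S₂) ω ∈ openConn c v₁} ∩ {ω | core Z (S₁ ∪ S₂) ω ∈ openConn c v₂}) *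
        (prodBernoulli v).real {ω | (((A ∩ S₁).filter fun a => inS S₁ v₁ ω ∈ openConn v₁ a).card + (if v₁ ∈ A then 1 else 0)) = 1} *
        (prodBernoulli v).real {ω | 1 ≤ (((A ∩ S₂).filter fun a => inS S₂ v₂ ω ∈ openConn v₂ a).card + (if v₂ ∈ A then 1 else 0))} +
      (prodBernoulli v).real ({ω | core Z (S₁ ∪ S₂) ω ∈ openConn c v₁} ∩ {ω | core Z (S₁ ∪ S₂) ω ∈ openConn c v₂}) *
        (prodBernoulli v).real {ω | (((A ∩ S₁).filter fun a => inS S₁ v₁ ω ∈ openConn v₁ a).card + (if v₁ ∈ A then 1 else 0)) = 0} *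
        (prodBernoulli v).real {ω | 2 ≤ (((A ∩ S₂).filter fun a => inS S₂ v₂ ω ∈ openConn v₂ a).card + (if v₂ ∈ A then 1 else 0))} := by
  set μ := prodBernoulli v with hμ
  have hmeas : ∀ U : Set (BondConfig (Fin n)), MeasurableSet U := fun U => (Set.toFinite U).measurableSet
  set A₁ := A ∩ S₁ with hA₁
  set A₂ := A ∩ S₂ with hA₂
  have hA₁L : A₁ ⊆ S₁ := fun a ha => (mem_inter.1 ha).2
  have hA₂L : A₂ ⊆ S₂ := fun a ha => (mem_inter.1 ha).2
  set b₁ : ℕ := (if v₁ ∈ A then 1 else 0) with hb₁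
  set b₂ : ℕ := (if v₂ ∈ A then 1 else 0) with hb₂
  set E₁ := {ω : BondConfig (Fin n) | core Z (S₁ ∪ S₂) ω ∈ openConn c v₁} with hE₁
  set E₂ := {ω : BondConfig (Fin n) | core Z (S₁ ∪ S₂) ω ∈ openConn c v₂} with hE₂
  set S := {ω : BondConfig (Fin n) | 2 ≤ ((A ∩ Z).filter fun a => onZ Z ω ∈ openConn c a).card} with hS
  set D₁ := {ω : BondConfig (Fin n) | 2 ≤ ((A₁.filter fun a => inS S₁ v₁ ω ∈ openConn v₁ a).card + b₁)} with hD₁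
  set D₂ := {ω : BondConfig (Fin n) | 2 ≤ ((A₂.filter fun a => inS S₂ v₂ ω ∈ openConn v₂ a).card + b₂)} with hD₂
  set G₂ := {ω : BondConfig (Fin n) | 1 ≤ ((A₂.filter fun a => inS S₂ v₂ ω ∈ openConn v₂ a).card + b₂)} with hG₂
  set O₁ := {ω : BondConfig (Fin n) | ((A₁.filter fun a => inS S₁ v₁ ω ∈ openConn v₁ a).card + b₁) = 1} with hO₁
  set Z₁ := {ω : BondConfig (Fin n) | ((A₁.filter fun a => inS S₁ v₁ ω ∈ openConn v₁ a).card + b₁) = 0} with hZ₁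
  have hX : ∀ ω, Good v₁ S₁ ω ∧ Good v₂ S₂ ω → ((A ∩ Z).filter fun a => onZ Z ω ∈ openConn c a).card =
      (if ω ∈ E₁ then ((A₁.filter fun a => inS S₁ v₁ ω ∈ openConn v₁ a).card + b₁) else 0) +
      (if ω ∈ E₂ then ((A₂.filter fun a => inS S₂ v₂ ω ∈ openConn v₂ a).card + b₂) else 0) := fun ω hω => card_on_eq_twoHub H hω.1 hω.2 hA
  have hdE : ∀ (P : Prop → Prop → Prop), DeterminedBy {ω | P (ω ∈ E₁) (ω ∈ E₂)} (↑(corePairs Z (S₁ ∪ S₂)) : Set (Sym2 (Fin n))) :=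
    fun P => determinedBy_core Z (S₁ ∪ S₂) fun η => P (η ∈ openConn c v₁) (η ∈ openConn c v₂)
  have hdD₁ : DeterminedBy D₁ (↑(hubPairs S₁ v₁) : Set (Sym2 (Fin n))) := determinedBy_hub S₁ v₁ A₁ fun k => 2 ≤ k + b₁
  have hdD₂ : DeterminedBy D₂ (↑(hubPairs S₂ v₂) : Set (Sym2 (Fin n))) := determinedBy_hub S₂ v₂ A₂ fun k => 2 ≤ k + b₂
  have hdG₂ : DeterminedBy G₂ (↑(hubPairs S₂ v₂) : Set (Sym2 (Fin n))) := determinedBy_hub S₂ v₂ A₂ fun k => 1 ≤ k + b₂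
  have hdO₁ : DeterminedBy O₁ (↑(hubPairs S₁ v₁) : Set (Sym2 (Fin n))) := determinedBy_hub S₁ v₁ A₁ fun k => k + b₁ = 1
  have hdZ₁ : DeterminedBy Z₁ (↑(hubPairs S₁ v₁) : Set (Sym2 (Fin n))) := determinedBy_hub S₁ v₁ A₁ fun k => k + b₁ = 0
  -- splits
  have s1 := measureReal_inter_add_sdiff (μ := μ) (s := S) (hmeas E₁)
  have s2 := measureReal_inter_add_sdiff (μ := μ) (s := S ∩ E₁) (hmeas E₂)
  have s3 := measureReal_inter_add_sdiff (μ := μ) (s := S \ E₁) (hmeas E₂)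
  have s4 := measureReal_inter_add_sdiff (μ := μ) (s := S ∩ E₁ ∩ E₂) (hmeas D₁)
  have s5 := measureReal_inter_add_sdiff (μ := μ) (s := (S ∩ E₁ ∩ E₂) \ D₁) (hmeas O₁)
  -- pieces
  have p1 : μ.real ((S ∩ E₁) \ E₂) = μ.real ({ω | ω ∈ E₁ ∧ ¬ ω ∈ E₂} ∩ D₁) := by
    refine real_congr_of_good₂ v hv₁ hv₂ _ _ fun ω hω => ?_
    simp only [Set.mem_sdiff, Set.mem_inter_iff, mem_setOf_eq, hS, hD₁]
    rw [hX ω hω]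
    by_cases h1 : ω ∈ E₁ <;> by_cases h2 : ω ∈ E₂ <;>
      simp only [h1, h2, if_true, if_false, true_and, and_true, false_and, and_false, not_true_eq_false, not_false_eq_true, add_zero, zero_add]
  have p2 : μ.real ((S \ E₁) ∩ E₂) = μ.real ({ω | ω ∈ E₂ ∧ ¬ ω ∈ E₁} ∩ D₂) := by
    refine real_congr_of_good₂ v hv₁ hv₂ _ _ fun ω hω => ?_
    simp only [Set.mem_sdiff, Set.mem_inter_iff, mem_setOf_eq, hS, hD₂]
    rw [hX ω hω]
    by_cases h1 : ω ∈ E₁ <;> by_cases h2 : ω ∈ E₂ <;>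
      simp only [h1, h2, if_true, if_false, true_and, and_true, false_and, and_false, not_true_eq_false, not_false_eq_true, add_zero, zero_add]
  have p3 : μ.real ((S \ E₁) \ E₂) = 0 := by
    have : μ.real ((S \ E₁) \ E₂) = μ.real (∅ : Set (BondConfig (Fin n))) := by
      refine real_congr_of_good₂ v hv₁ hv₂ _ _ fun ω hω => ?_
      simp only [Set.mem_sdiff, mem_setOf_eq, hS, Set.mem_empty_iff_false, iff_false]
      rw [hX ω hω]
      by_cases h1 : ω ∈ E₁ <;> by_cases h2 : ω ∈ E₂ <;>
        simp only [h1, h2, if_true, if_false, and_true, and_false, not_true_eq_false, not_false_eq_true, add_zero, zero_add, not_le]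
      omega
    rw [this, measureReal_empty]
  have p4 : μ.real (S ∩ E₁ ∩ E₂ ∩ D₁) = μ.real ({ω | ω ∈ E₁ ∧ ω ∈ E₂} ∩ D₁) := by
    refine real_congr_of_good₂ v hv₁ hv₂ _ _ fun ω hω => ?_
    simp only [Set.mem_inter_iff, mem_setOf_eq, hS, hD₁]
    rw [hX ω hω]
    by_cases h1 : ω ∈ E₁ <;> by_cases h2 : ω ∈ E₂ <;>
      simp only [h1, h2, if_true, if_false, true_and, and_true, false_and, and_false, add_zero, zero_add]
    omega
  have p5 : μ.real (((S ∩ E₁ ∩ E₂) \ D₁) ∩ O₁) = μ.real ({ω | ω ∈ E₁ ∧ ω ∈ E₂} ∩ O₁ ∩ G₂) := by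
    refine real_congr_of_good₂ v hv₁ hv₂ _ _ fun ω hω => ?_
    simp only [Set.mem_sdiff, Set.mem_inter_iff, mem_setOf_eq, hS, hD₁, hO₁, hG₂]
    rw [hX ω hω]
    by_cases h1 : ω ∈ E₁ <;> by_cases h2 : ω ∈ E₂ <;>
      simp only [h1, h2, if_true, if_false, true_and, and_true, false_and, and_false, add_zero, zero_add, not_le]
    omega
  have p6 : μ.real (((S ∩ E₁ ∩ E₂) \ D₁) \ O₁) = μ.real ({ω | ω ∈ E₁ ∧ ω ∈ E₂} ∩ Z₁ ∩ D₂) := by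
    refine real_congr_of_good₂ v hv₁ hv₂ _ _ fun ω hω => ?_
    simp only [Set.mem_sdiff, Set.mem_inter_iff, mem_setOf_eq, hS, hD₁, hO₁, hZ₁, hD₂]
    rw [hX ω hω]
    by_cases h1 : ω ∈ E₁ <;> by_cases h2 : ω ∈ E₂ <;>
      simp only [h1, h2, if_true, if_false, true_and, and_true, false_and, and_false, add_zero, zero_add, not_le]
    omega
  rw [real_core_hub₁ H v (hdE fun a b => a ∧ ¬ b) hdD₁] at p1
  rw [real_core_hub₂ H v (hdE fun a b => b ∧ ¬ a) hdD₂] at p2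
  rw [real_core_hub₁ H v (hdE fun a b => a ∧ b) hdD₁] at p4
  rw [real_core_hub_hub H v (hdE fun a b => a ∧ b) hdO₁ hdG₂] at p5
  rw [real_core_hub_hub H v (hdE fun a b => a ∧ b) hdZ₁ hdD₂] at p6
  have e10 : {ω : BondConfig (Fin n) | ω ∈ E₁ ∧ ¬ ω ∈ E₂} = E₁ \ E₂ := rfl
  have e01 : {ω : BondConfig (Fin n) | ω ∈ E₂ ∧ ¬ ω ∈ E₁} = E₂ \ E₁ := rfl
  have e11 : {ω : BondConfig (Fin n) | ω ∈ E₁ ∧ ω ∈ E₂} = E₁ ∩ E₂ := rfl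
  rw [e10] at p1; rw [e01] at p2; rw [e11] at p4 p5 p6
  linarith [s1, s2, s3, s4, s5, p1, p2, p3, p4, p5, p6]



end TwoHub

end Block

end Quant

end Summit.CriticalPhenomena.PercolationContinuityZ3.Theorems
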